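import Summits.ABC.IUTFork.Repair.RHTieDeciderSqrtNegOneQ2
import Summits.ABC.IUTFork.Repair.RHReachLedgerQ2GenuineTiesUnitRationalJ
import HarnessLib

/-!
# R-H ROUND 2 Q2(27) — `outerUnit` class with (O″) owed ONLY at the bad primes `p ≢ 3 (mod 4)` («modFour», abc-iut-rh-typ-12's parity door),
# RATIONAL-`j` / RATIONAL-`λ` bed, and its R14 recut:
# `K2Target27 ⟸ (j(λ) ∈ ℚ ∧ (outerUnit off p ≡ 3 (mod 4)))|Σ₂₇`; `HStar27OnSigma27 ∧ STRUCT|Σ₂₇ ∧ NUM(deep ∧ bad) ∧ CONE-bad ⟹ ABC`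

PROOF-ONLY file (0 definitions, 0 `Prop` facts, no instance, no notation; abc-iut cell, D-0079 RESCUE sub-cell R-H, rung LADDER-ABC:A2.RESCUE.H;
pair n = 10 typer abc-iut-rh-typ-10 gen 7 (R14 recut lane for row 27); sequel BY NAME to abc-iut-rh-typ-12's `Repair/RHTieDeciderSqrtNegOneQ2.lean`
(`TieDecider.k2Target27_of_isGalois_outerUnit_modFour`, `TieDecider.cor312NonarchOf_of_ledgerAtDatum_outerUnit_of_isGalois_modFour`: abc-iut-rh2-L1's
8/8 `RHReachLedgerQ2GenuineTiesUnit` doors VERBATIM except that (O″) carries the extra antecedent `p % 4 ≠ 3` — at `p ≡ 3 (mod 4)` the clause holds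
because `√−1 ∈ K` forces `f(𝔭_x∣p)` even, [IUTchI] Def. 3.1 (a)) and to this seat's `Repair/RHReachLedgerQ2GenuineTiesUnitRationalJ.lean` (p484151;
pattern verbatim, `outerUnit ↦ outerUnit_modFour`). TAKES NO SIDE on [IUTchIII] Cor. 3.12 / [IUTchIV] Thm. 1.10 or on any author (Mochizuki /
Scholze–Stix / Joshi / Dupuy–Hilado); typed ≠ proved; instantiated ≠ endorsed; nothing here asserts abc proved or refuted.
* §1 `cor312NonarchOf_of_ledgerAtDatum_outerUnit_modFour_of_jInv_mem_range` — the per-datum first arrow with the Galois hypothesis DISCHARGED by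
  `j(λ) ∈ ℚ` (p482181 `isGalois_rat_K_of_jInv_mem_range`) and (O″) owed only at the bad `p ≢ 3 (mod 4)`; `cor312NonarchOf_of_ledgerAtDatum_outerUnit_modFour_ratPoint`
  — at a `ℚ`-rational point (`ratPoint q`: the Frey–Hellegouarch bed, the `λ_k = 1/2 + 2/7^k` HEX / lamSeven beds) NO `j` / Galois / witness hypothesis at all
  (p484151 `isGalois_rat_K_ratPoint`); `k2Target27_of_jInv_mem_range_outerUnit_modFour` / `k2Target27_of_x_mem_range_outerUnit_modFour` — `K2Target27` from ONE
  structural hypothesis on Σ₂₇ (`j(λ) ∈ ℚ` resp. `λ ∈ ℚ`, plus (O″) off `p ≡ 3 (mod 4)`): explicit 1, NO witness data, NO Galois hypothesis.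
* §2 the R14 RECUT of both roads: `abc_of_hStar27OnSigma27_of_isGalois_outerUnit_modFour_hregBad` (abc-iut-rh-typ-12's hypothesis VERBATIM) and
  `abc_of_hStar27OnSigma27_of_jInv_mem_range_outerUnit_modFour_hregBad`, over p480035's `abc_of_k2Target27_of_hStar27OnSigma27_hregBad` (cone binder cut to
  the SZPIRO-BAD locus, abc-iut-s2-p2's `hregBad` VERBATIM — NOT the blanket `hreg`, which `Conditional.not_hreg_v4` refutes). Explicit 4 = H⋆₂₇(Σ₂₇) ·
  STRUCT(Σ₂₇) · NUM(deep ∧ bad) · CONE(Szpiro-bad).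
KERNEL-EXACT RESIDUAL of row 27's certificate binder on the rational-`λ` / rational-`j` beds after this file: a Σ₂₇ datum with a BAD prime
`p ≡ 1 (mod 4)` (or `p = 2`) of cyclotomic index `e_p = p^a(p−1)` carrying a residue-degree-`1` place with no uniformizer `π`, `‖1 + π^e/p‖ = 1` —
EMPTY on abc-iut-rh2-q3-num's 258-datum Q3 universe (its one tied triple λ₇ @ `l = 41`, `p = 1231 ≡ 3 (mod 4)` is decided by the parity door);
a table fact, not a kernel statement.
HONEST SCOPE. H⋆₂₇ (`HStar27OnSigma27`, row 27 «reach-ledger», abc-iut-lens-nearmiss-1) is a HYPOTHESIS SHAPE over OUR typed objects (Dupuy–Hilado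
(Ind2) = all `ℤ_p`-lattice automorphisms, STRONGER-THAN-PRINT; SHARP boxes; volume reading of Step (xi)); which genuine data satisfy it is
abc-iut-rh-num-1's table (k1 74.8 % pooled / 98.9 % on frey Szpiro-bad ∧ window), not a theorem; `hregBad` is an assumption label, neither proved
nor refuted as typed; `K2Target27` stays OPEN as typed off the structural class. [cite: Mochizuki2012, IUTchI Def. 3.1 (a),(b) p. 61, Rmk. 3.1.5 p. 65;
IUTchIII Cor. 3.12 p. 173–174; IUTchIV Thm. 1.10 p. 22, Cor. 2.2 (ii) p. 46] [cite: NeukirchANT1999, Ch. I §8, §9 (9.1), Ch. II (5.5)–(5.7)]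
[cite: IrelandRosen1990, Ch. 5 §1 Prop. 5.1.2] [cite: DupuyHilado2025, §1 (1.1), §3.4, §3.9, §4.9] [cite: MochizukiGenEll2010, Ex 1.3 (i) p.5]
[claim: Mochizuki2012, status: disputed] for every IUT sentence quoted. Axioms: standard.
-/

noncomputable section

open Set Function NumberField IsDedekindDomain

namespace Summit.ABC.IUTFork.Repair.RH.ReachLedgerQ2

open Thm311 Thm311.Real Cor312 Cor312Vol Cor312Prov Literature.IUT.LogThetaLattice Literature.IUT.LogVolume
  Literature.IUT.HodgeTheaters Literature.IUT.LogVolume.ThetaData Summit.ABC.IUTFork.Repair.RH.ReachLedger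
open Literature.NumberTheory.DiophantineGeometry Literature.NumberTheory.DiophantineGeometry.GenEll Summit.ABC.ABC.Theorems
  Summit.ABC.IUTFork.Conditional
open scoped Classical

section KFamily

variable
    (M : ∀ (P : NFPoint) (l : ℕ) (T : Cor22.ThetaVolumeDatumAt P l), Type) [∀ P l T, Field (M P l T)] [∀ P l T, NumberField (M P l T)]
    (archPk : ∀ (P : NFPoint) (l : ℕ) (T : Cor22.ThetaVolumeDatumAt P l), letI := T.instFieldF; letI := T.instNumberFieldF; letI := T.instAlgebraF; letI := T.instFieldK;
        letI := T.instNumberFieldK; letI := T.instAlgebraK; letI := T.instFieldFbar; letI := T.instAlgebraFbar;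
        letI := T.instAlgebraKFbar; letI := T.instIsElliptic;
      ∀ (j : (thetaIndex (pilotDataOfK T.D T.K)).Label) (vQ : (thetaIndex (pilotDataOfK T.D T.K)).VQ), Set ((logShellsDH (pilotDataOfK T.D T.K) (analyticLogv T.K)).Packet j vQ))
    (archSub : ∀ (P : NFPoint) (l : ℕ) (T : Cor22.ThetaVolumeDatumAt P l), letI := T.instFieldF; letI := T.instNumberFieldF; letI := T.instAlgebraF; letI := T.instFieldK;
        letI := T.instNumberFieldK; letI := T.instAlgebraK; letI := T.instFieldFbar; letI := T.instAlgebraFbar;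
        letI := T.instAlgebraKFbar; letI := T.instIsElliptic;
      ∀ (j : (thetaIndex (pilotDataOfK T.D T.K)).Label) (v : (thetaIndex (pilotDataOfK T.D T.K)).V), Set ((logShellsDH (pilotDataOfK T.D T.K) (analyticLogv T.K)).Packet j ((thetaIndex (pilotDataOfK T.D T.K)).over v)))
    (Ψ : ∀ (P : NFPoint) (l : ℕ) (T : Cor22.ThetaVolumeDatumAt P l), letI := T.instFieldF; letI := T.instNumberFieldF; letI := T.instAlgebraF; letI := T.instFieldK;
        letI := T.instNumberFieldK; letI := T.instAlgebraK; letI := T.instFieldFbar; letI := T.instAlgebraFbar;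
        letI := T.instAlgebraKFbar; letI := T.instIsElliptic;
      ℤ → ∀ v : (thetaIndex (pilotDataOfK T.D T.K)).V, v ∈ (thetaIndex (pilotDataOfK T.D T.K)).Vbad → Set ((logShellsDH (pilotDataOfK T.D T.K) (analyticLogv T.K)).StarPacket v))
    (act : ∀ (P : NFPoint) (l : ℕ) (T : Cor22.ThetaVolumeDatumAt P l), letI := T.instFieldF; letI := T.instNumberFieldF; letI := T.instAlgebraF; letI := T.instFieldK;
        letI := T.instNumberFieldK; letI := T.instAlgebraK; letI := T.instFieldFbar; letI := T.instAlgebraFbar;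
        letI := T.instAlgebraKFbar; letI := T.instIsElliptic;
      ℤ → ∀ v : (thetaIndex (pilotDataOfK T.D T.K)).V, v ∈ (thetaIndex (pilotDataOfK T.D T.K)).Vbad → (logShellsDH (pilotDataOfK T.D T.K) (analyticLogv T.K)).StarPacket v → Module.End ℚ ((logShellsDH (pilotDataOfK T.D T.K) (analyticLogv T.K)).StarPacket v))
    (Mmod : ∀ (P : NFPoint) (l : ℕ) (T : Cor22.ThetaVolumeDatumAt P l), letI := T.instFieldF; letI := T.instNumberFieldF; letI := T.instAlgebraF; letI := T.instFieldK;
        letI := T.instNumberFieldK; letI := T.instAlgebraK; letI := T.instFieldFbar; letI := T.instAlgebraFbar;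
        letI := T.instAlgebraKFbar; letI := T.instIsElliptic;
      ℤ → ∀ j : (thetaIndex (pilotDataOfK T.D T.K)).LabelStar, Set ((logShellsDH (pilotDataOfK T.D T.K) (analyticLogv T.K)).GlobalPacket j.1))
    (region : ∀ (P : NFPoint) (l : ℕ) (T : Cor22.ThetaVolumeDatumAt P l), letI := T.instFieldF; letI := T.instNumberFieldF; letI := T.instAlgebraF; letI := T.instFieldK;
        letI := T.instNumberFieldK; letI := T.instAlgebraK; letI := T.instFieldFbar; letI := T.instAlgebraFbar;
        letI := T.instAlgebraKFbar; letI := T.instIsElliptic;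
      ℤ → ∀ j : (thetaIndex (pilotDataOfK T.D T.K)).LabelStar, FinDivisor (M P l T) → ∀ vQ : (thetaIndex (pilotDataOfK T.D T.K)).VQ, Set ((logShellsDH (pilotDataOfK T.D T.K) (analyticLogv T.K)).Packet j.1 vQ))
    (n : ∀ (P : NFPoint) (l : ℕ) (T : Cor22.ThetaVolumeDatumAt P l), ℤ)
    {HT : ∀ (P : NFPoint) (l : ℕ) (T : Cor22.ThetaVolumeDatumAt P l), Type} {LogLink : ∀ (P : NFPoint) (l : ℕ) (T : Cor22.ThetaVolumeDatumAt P l), HT P l T → HT P l T → Type}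
    {IsFull : ∀ (P : NFPoint) (l : ℕ) (T : Cor22.ThetaVolumeDatumAt P l), ∀ {s t : HT P l T}, LogLink P l T s t → Prop}
    (lat : ∀ (P : NFPoint) (l : ℕ) (T : Cor22.ThetaVolumeDatumAt P l), LGPGaussianLogThetaLattice (LogLink P l T) (IsFull P l T))
    {Frd : ∀ (P : NFPoint) (l : ℕ) (T : Cor22.ThetaVolumeDatumAt P l), Type} {IsoF : ∀ (P : NFPoint) (l : ℕ) (T : Cor22.ThetaVolumeDatumAt P l), Frd P l T → Frd P l T → Type} {Ob : ∀ (P : NFPoint) (l : ℕ) (T : Cor22.ThetaVolumeDatumAt P l), Frd P l T → Type}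
    {realify : ∀ (P : NFPoint) (l : ℕ) (T : Cor22.ThetaVolumeDatumAt P l), Frd P l T → Frd P l T} {Strip : ∀ (P : NFPoint) (l : ℕ) (T : Cor22.ThetaVolumeDatumAt P l), Type} {IsoS : ∀ (P : NFPoint) (l : ℕ) (T : Cor22.ThetaVolumeDatumAt P l), Strip P l T → Strip P l T → Type}
    {Mv : ∀ (P : NFPoint) (l : ℕ) (T : Cor22.ThetaVolumeDatumAt P l), letI := T.instFieldF; letI := T.instNumberFieldF; letI := T.instAlgebraF; letI := T.instFieldK;
        letI := T.instNumberFieldK; letI := T.instAlgebraK; letI := T.instFieldFbar; letI := T.instAlgebraFbar;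
        letI := T.instAlgebraKFbar; letI := T.instIsElliptic;
      ∀ v : (thetaIndex (pilotDataOfK T.D T.K)).V, v ∈ (thetaIndex (pilotDataOfK T.D T.K)).Vbad → Type}
    [∀ P l T v h, Monoid (Mv P l T v h)]
    (sig : ∀ (P : NFPoint) (l : ℕ) (T : Cor22.ThetaVolumeDatumAt P l), letI := T.instFieldF; letI := T.instNumberFieldF; letI := T.instAlgebraF; letI := T.instFieldK;
        letI := T.instNumberFieldK; letI := T.instAlgebraK; letI := T.instFieldFbar; letI := T.instAlgebraFbar;
        letI := T.instAlgebraKFbar; letI := T.instIsElliptic;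
      GlobalLGPFrobenioidSignature (thetaIndex (pilotDataOfK T.D T.K)).lstar (thetaIndex (pilotDataOfK T.D T.K)).V (· ∈ (thetaIndex (pilotDataOfK T.D T.K)).Vbad) (Frd P l T) (IsoF P l T) (Ob P l T) (realify P l T)
        (Strip P l T) (IsoS P l T) (Mv P l T))
    (split : ∀ (P : NFPoint) (l : ℕ) (T : Cor22.ThetaVolumeDatumAt P l), SplittingMonoids (Mv P l T))
    {ObΔ : ∀ (P : NFPoint) (l : ℕ) (T : Cor22.ThetaVolumeDatumAt P l), Type} {N : ∀ (P : NFPoint) (l : ℕ) (T : Cor22.ThetaVolumeDatumAt P l), letI := T.instFieldF; letI := T.instNumberFieldF; letI := T.instAlgebraF; letI := T.instFieldK;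
        letI := T.instNumberFieldK; letI := T.instAlgebraK; letI := T.instFieldFbar; letI := T.instAlgebraFbar;
        letI := T.instAlgebraKFbar; letI := T.instIsElliptic;
      ∀ v : (thetaIndex (pilotDataOfK T.D T.K)).V, v ∈ (thetaIndex (pilotDataOfK T.D T.K)).Vbad → Type}
    [∀ P l T v h, Monoid (N P l T v h)] (qData : ∀ (P : NFPoint) (l : ℕ) (T : Cor22.ThetaVolumeDatumAt P l), QPilotData (ObΔ P l T) (N P l T))


include M archPk archSub Ψ act Mmod region n lat sig split qData in
/-- **RATIONAL-`j` rows, class `outerUnit` with (O″) owed only at the bad `p ≢ 3 (mod 4)`: `LedgerAtDatum T` ∧ (outerUnit at the bad places `p ≢ 3 (mod 4)`) ⟹ `T.Cor312NonarchOf`** — abc-iut-rh-typ-12's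
`TieDecider.cor312NonarchOf_of_ledgerAtDatum_outerUnit_of_isGalois_modFour` with its Galois hypothesis DISCHARGED by `isGalois_rat_K_of_jInv_mem_range` (`j(λ) ∈ ℚ`). Row 27's ledger is a
HYPOTHESIS; no side taken on [IUTchIII] Cor. 3.12. [cite: Mochizuki2012, IUTchI Rmk. 3.1.5 p. 65; IUTchIII Cor. 3.12 p. 173–174]
[cite: NeukirchANT1999, Ch. I §9 (9.1), Ch. II (5.5)–(5.7)] [claim: Mochizuki2012, status: disputed] -/
theorem cor312NonarchOf_of_ledgerAtDatum_outerUnit_modFour_of_jInv_mem_range {P : NFPoint} {l : ℕ} (T : Cor22.ThetaVolumeDatumAt P l)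
    (hj : Cor22.jInv P.x ∈ Set.range (algebraMap ℚ P.F))
    (hO : letI := T.instFieldF; letI := T.instNumberFieldF; letI := T.instAlgebraF; letI := T.instFieldK;
        letI := T.instNumberFieldK; letI := T.instAlgebraK; letI := T.instFieldFbar; letI := T.instAlgebraFbar;
        letI := T.instAlgebraKFbar; letI := T.instIsElliptic;
      ∀ (pp : Nat.Primes) (w : (thetaIndex (pilotDataOfK T.D T.K)).Fibre (.inr pp)), haveI : Fact (pp : ℕ).Prime := ⟨pp.2⟩
        placeOf (pilotDataOfK T.D T.K) pp.1 w ∈ (pilotDataOfK T.D T.K).S → (pp : ℕ) % 4 ≠ 3 →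
          (∀ a : ℕ, (((placeOf (pilotDataOfK T.D T.K) pp.1 w).asIdeal.ramificationIdx ℤ : ℕ) : ℤ) ≠
              ((pp : ℕ) : ℤ) ^ a * (((pp : ℕ) : ℤ) - 1)) ∨
            ∀ x : (thetaIndex (pilotDataOfK T.D T.K)).Fibre (.inr pp),
              2 ≤ (placeOf (pilotDataOfK T.D T.K) pp.1 x).asIdeal.inertiaDeg ℤ ∨
                ∃ π : kOf (pilotDataOfK T.D T.K) pp.1 x,
                  ‖π‖ = ((pp : ℕ) : ℝ) ^ (-(1 : ℝ) / ((placeOf (pilotDataOfK T.D T.K) pp.1 w).asIdeal.ramificationIdx ℤ : ℝ)) ∧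
                    ‖1 + π ^ ((placeOf (pilotDataOfK T.D T.K) pp.1 w).asIdeal.ramificationIdx ℤ) /
                      ((pp : ℕ) : kOf (pilotDataOfK T.D T.K) pp.1 x)‖ = 1)
    (hL : LedgerAtDatum T) :
    T.Cor312NonarchOf :=
  TieDecider.cor312NonarchOf_of_ledgerAtDatum_outerUnit_of_isGalois_modFour M archPk archSub Ψ act Mmod region n lat sig split qData T
    (isGalois_rat_K_of_jInv_mem_range T hj) hO hL

include M archPk archSub Ψ act Mmod region n lat sig split qData in
/-- **AT A `ℚ`-RATIONAL POINT: `LedgerAtDatum T` ∧ (outerUnit off `p ≡ 3 (mod 4)` at the bad places) ⟹ `T.Cor312NonarchOf`** — no `j`, no Galois,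
no witness hypothesis, and NO clause at the bad primes `p ≡ 3 (mod 4)`: p484151's `isGalois_rat_K_ratPoint` into abc-iut-rh-typ-12's
`TieDecider.cor312NonarchOf_of_ledgerAtDatum_outerUnit_of_isGalois_modFour`. The per-datum form of row 27's first arrow on the frey / `λ_k` beds
(253/258 data of abc-iut-rh2-q3-num's Q3 universe). Row 27's ledger is a HYPOTHESIS; no side taken on [IUTchIII] Cor. 3.12.
[cite: Mochizuki2012, IUTchI Def. 3.1 (a) p. 61, Rmk. 3.1.5 p. 65; IUTchIII Cor. 3.12 p. 173–174] [cite: NeukirchANT1999, Ch. I §8, §9 (9.1), Ch. II (5.5)–(5.7)]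
[cite: MochizukiGenEll2010, Ex 1.3 (i) p.5] [claim: Mochizuki2012, status: disputed] -/
theorem cor312NonarchOf_of_ledgerAtDatum_outerUnit_modFour_ratPoint (q : ℚ) {l : ℕ} (T : Cor22.ThetaVolumeDatumAt (ratPoint q) l)
    (hO : letI := T.instFieldF; letI := T.instNumberFieldF; letI := T.instAlgebraF; letI := T.instFieldK;
        letI := T.instNumberFieldK; letI := T.instAlgebraK; letI := T.instFieldFbar; letI := T.instAlgebraFbar;
        letI := T.instAlgebraKFbar; letI := T.instIsElliptic;
      ∀ (pp : Nat.Primes) (w : (thetaIndex (pilotDataOfK T.D T.K)).Fibre (.inr pp)), haveI : Fact (pp : ℕ).Prime := ⟨pp.2⟩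
        placeOf (pilotDataOfK T.D T.K) pp.1 w ∈ (pilotDataOfK T.D T.K).S → (pp : ℕ) % 4 ≠ 3 →
          (∀ a : ℕ, (((placeOf (pilotDataOfK T.D T.K) pp.1 w).asIdeal.ramificationIdx ℤ : ℕ) : ℤ) ≠
              ((pp : ℕ) : ℤ) ^ a * (((pp : ℕ) : ℤ) - 1)) ∨
            ∀ x : (thetaIndex (pilotDataOfK T.D T.K)).Fibre (.inr pp),
              2 ≤ (placeOf (pilotDataOfK T.D T.K) pp.1 x).asIdeal.inertiaDeg ℤ ∨
                ∃ π : kOf (pilotDataOfK T.D T.K) pp.1 x,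
                  ‖π‖ = ((pp : ℕ) : ℝ) ^ (-(1 : ℝ) / ((placeOf (pilotDataOfK T.D T.K) pp.1 w).asIdeal.ramificationIdx ℤ : ℝ)) ∧
                    ‖1 + π ^ ((placeOf (pilotDataOfK T.D T.K) pp.1 w).asIdeal.ramificationIdx ℤ) /
                      ((pp : ℕ) : kOf (pilotDataOfK T.D T.K) pp.1 x)‖ = 1)
    (hL : LedgerAtDatum T) :
    T.Cor312NonarchOf :=
  TieDecider.cor312NonarchOf_of_ledgerAtDatum_outerUnit_of_isGalois_modFour M archPk archSub Ψ act Mmod region n lat sig split qData T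
    (isGalois_rat_K_ratPoint q T) hO hL

include M archPk archSub Ψ act Mmod region n lat sig split qData in
/-- **`K2Target27` on the RATIONAL-`j` stratum, class `outerUnit` with (O″) owed only at the bad `p ≢ 3 (mod 4)`** — from ONE structural hypothesis: every Σ₂₇ datum (antecedents of `K2Target27`
VERBATIM) has `j(λ) ∈ ℚ` and the class condition at its bad places. Explicit 1; NO witness data, NO Galois hypothesis (abc-iut-rh-typ-12's
`TieDecider.k2Target27_of_isGalois_outerUnit_modFour` with Galois-ness from `j(λ) ∈ ℚ`). [cite: NeukirchANT1999, Ch. I §9 (9.1), Ch. II (5.5)–(5.7)] [claim: Mochizuki2012, status: disputed] -/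
theorem k2Target27_of_jInv_mem_range_outerUnit_modFour
    (hJO : ∀ (P : NFPoint), P ∈ UP → ∀ (l : ℕ), l.Prime → 5 ≤ l →
      Cor22.AdmitsCore P → Cor22.CondP2 P l → Cor22.CondP5 P l → Cor22.CondP6 P l →
      (((l : ℝ) + 5) / 4 < (Cor22.dmod P : ℝ) ∨
        6 * l * (((l : ℝ) + 5) - 4 * Cor22.dmod P) / (((l : ℝ) + 4) * ((l : ℝ) - 3))
            * (P.logDiff + (1 - 1 / (l : ℝ)) * Cor22.logCondAvoid P {2, l})
          + 6 * l * ((l : ℝ) + 5) / (((l : ℝ) + 4) * ((l : ℝ) - 3)) * Real.log Real.pi < Cor22.logQAvoid P {2, l}) →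
      ∀ (T : Cor22.ThetaVolumeDatumAt P l), letI := T.instFieldF; letI := T.instNumberFieldF; letI := T.instAlgebraF; letI := T.instFieldK;
        letI := T.instNumberFieldK; letI := T.instAlgebraK; letI := T.instFieldFbar; letI := T.instAlgebraFbar;
        letI := T.instAlgebraKFbar; letI := T.instIsElliptic;
      ¬ (∃ (pp : Nat.Primes) (_ : 2 < (pp : ℕ)) (i : Fin (thetaIndex (pilotDataOfK T.D T.K)).lstar)
          (x₀ : (thetaIndex (pilotDataOfK T.D T.K)).Fibre (.inr pp)),
        haveI : Fact (pp : ℕ).Prime := ⟨pp.2⟩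
        ((pp : ℕ) : ℝ) ^ ((((i : ℕ) : ℝ) + 2) * (4 + 2 * Real.logb (pp : ℕ) (Module.finrank ℚ T.K)) + 1) *
          ‖(exists_realising_qIdeles_pilotDataOfK T.D).choose pp x₀‖ ^ (((i : ℕ) + 1) ^ 2 - 1) < 1) →
      Cor22.jInv P.x ∈ Set.range (algebraMap ℚ P.F) ∧
      (∀ (pp : Nat.Primes) (w : (thetaIndex (pilotDataOfK T.D T.K)).Fibre (.inr pp)), haveI : Fact (pp : ℕ).Prime := ⟨pp.2⟩
        placeOf (pilotDataOfK T.D T.K) pp.1 w ∈ (pilotDataOfK T.D T.K).S → (pp : ℕ) % 4 ≠ 3 →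
          (∀ a : ℕ, (((placeOf (pilotDataOfK T.D T.K) pp.1 w).asIdeal.ramificationIdx ℤ : ℕ) : ℤ) ≠
              ((pp : ℕ) : ℤ) ^ a * (((pp : ℕ) : ℤ) - 1)) ∨
            ∀ x : (thetaIndex (pilotDataOfK T.D T.K)).Fibre (.inr pp),
              2 ≤ (placeOf (pilotDataOfK T.D T.K) pp.1 x).asIdeal.inertiaDeg ℤ ∨
                ∃ π : kOf (pilotDataOfK T.D T.K) pp.1 x,
                  ‖π‖ = ((pp : ℕ) : ℝ) ^ (-(1 : ℝ) / ((placeOf (pilotDataOfK T.D T.K) pp.1 w).asIdeal.ramificationIdx ℤ : ℝ)) ∧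
                    ‖1 + π ^ ((placeOf (pilotDataOfK T.D T.K) pp.1 w).asIdeal.ramificationIdx ℤ) /
                      ((pp : ℕ) : kOf (pilotDataOfK T.D T.K) pp.1 x)‖ = 1)) :
    K2Target27 := by
  intro P hP l hl h5 hc h2 h5' h6 hbad T hwin hL
  obtain ⟨hj, hO⟩ := hJO P hP l hl h5 hc h2 h5' h6 hbad T hwin
  exact cor312NonarchOf_of_ledgerAtDatum_outerUnit_modFour_of_jInv_mem_range M archPk archSub Ψ act Mmod region n lat sig split qData T hj hO hL

include M archPk archSub Ψ act Mmod region n lat sig split qData in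
/-- **`K2Target27` on the RATIONAL-`λ` stratum (Frey–Hellegouarch / `λ_k` presentations), class `outerUnit` with (O″) owed only at the bad `p ≢ 3 (mod 4)`** — every Σ₂₇ datum has `λ ∈ ℚ` and the
class condition at its bad places ⟹ `K2Target27`; a λ-term over `k2Target27_of_jInv_mem_range_outerUnit_modFour` via `jInv_mem_range_of_mem_range`.
Explicit 1, no witness data. [cite: MochizukiGenEll2010, §1 p.4] [cite: NeukirchANT1999, Ch. II (5.5)–(5.7)] [claim: Mochizuki2012, status: disputed] -/
theorem k2Target27_of_x_mem_range_outerUnit_modFour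
    (hXO : ∀ (P : NFPoint), P ∈ UP → ∀ (l : ℕ), l.Prime → 5 ≤ l →
      Cor22.AdmitsCore P → Cor22.CondP2 P l → Cor22.CondP5 P l → Cor22.CondP6 P l →
      (((l : ℝ) + 5) / 4 < (Cor22.dmod P : ℝ) ∨
        6 * l * (((l : ℝ) + 5) - 4 * Cor22.dmod P) / (((l : ℝ) + 4) * ((l : ℝ) - 3))
            * (P.logDiff + (1 - 1 / (l : ℝ)) * Cor22.logCondAvoid P {2, l})
          + 6 * l * ((l : ℝ) + 5) / (((l : ℝ) + 4) * ((l : ℝ) - 3)) * Real.log Real.pi < Cor22.logQAvoid P {2, l}) →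
      ∀ (T : Cor22.ThetaVolumeDatumAt P l), letI := T.instFieldF; letI := T.instNumberFieldF; letI := T.instAlgebraF; letI := T.instFieldK;
        letI := T.instNumberFieldK; letI := T.instAlgebraK; letI := T.instFieldFbar; letI := T.instAlgebraFbar;
        letI := T.instAlgebraKFbar; letI := T.instIsElliptic;
      ¬ (∃ (pp : Nat.Primes) (_ : 2 < (pp : ℕ)) (i : Fin (thetaIndex (pilotDataOfK T.D T.K)).lstar)
          (x₀ : (thetaIndex (pilotDataOfK T.D T.K)).Fibre (.inr pp)),
        haveI : Fact (pp : ℕ).Prime := ⟨pp.2⟩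
        ((pp : ℕ) : ℝ) ^ ((((i : ℕ) : ℝ) + 2) * (4 + 2 * Real.logb (pp : ℕ) (Module.finrank ℚ T.K)) + 1) *
          ‖(exists_realising_qIdeles_pilotDataOfK T.D).choose pp x₀‖ ^ (((i : ℕ) + 1) ^ 2 - 1) < 1) →
      P.x ∈ Set.range (algebraMap ℚ P.F) ∧
      (∀ (pp : Nat.Primes) (w : (thetaIndex (pilotDataOfK T.D T.K)).Fibre (.inr pp)), haveI : Fact (pp : ℕ).Prime := ⟨pp.2⟩
        placeOf (pilotDataOfK T.D T.K) pp.1 w ∈ (pilotDataOfK T.D T.K).S → (pp : ℕ) % 4 ≠ 3 →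
          (∀ a : ℕ, (((placeOf (pilotDataOfK T.D T.K) pp.1 w).asIdeal.ramificationIdx ℤ : ℕ) : ℤ) ≠
              ((pp : ℕ) : ℤ) ^ a * (((pp : ℕ) : ℤ) - 1)) ∨
            ∀ x : (thetaIndex (pilotDataOfK T.D T.K)).Fibre (.inr pp),
              2 ≤ (placeOf (pilotDataOfK T.D T.K) pp.1 x).asIdeal.inertiaDeg ℤ ∨
                ∃ π : kOf (pilotDataOfK T.D T.K) pp.1 x,
                  ‖π‖ = ((pp : ℕ) : ℝ) ^ (-(1 : ℝ) / ((placeOf (pilotDataOfK T.D T.K) pp.1 w).asIdeal.ramificationIdx ℤ : ℝ)) ∧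
                    ‖1 + π ^ ((placeOf (pilotDataOfK T.D T.K) pp.1 w).asIdeal.ramificationIdx ℤ) /
                      ((pp : ℕ) : kOf (pilotDataOfK T.D T.K) pp.1 x)‖ = 1)) :
    K2Target27 := by
  refine k2Target27_of_jInv_mem_range_outerUnit_modFour M archPk archSub Ψ act Mmod region n lat sig split qData
    (fun P hP l hl h5 hc h2 h5' h6 hbad T hwin => ?_)
  obtain ⟨hx, hO⟩ := hXO P hP l hl h5 hc h2 h5' h6 hbad T hwin
  exact ⟨jInv_mem_range_of_mem_range hx, hO⟩

/-! ## §2. The R14 recut of the class-`outerUnit`-off-`p ≡ 3 (mod 4)` roads to abc (`hregBad`, abc-iut-s2-p2's binder VERBATIM) -/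

include M archPk archSub Ψ act Mmod region n lat sig split qData in
/-- **EXPLICIT-4, recut, class `outerUnit` with (O″) owed only at the bad `p ≢ 3 (mod 4)`: `HStar27OnSigma27 ∧ (K/ℚ Galois ∧ outerUnit off p ≡ 3 (mod 4))|Σ₂₇ ∧ NUM(deep ∧ bad) ∧ CONE-bad ⟹ ABC`** — abc-iut-rh-typ-12's
`TieDecider.k2Target27_of_isGalois_outerUnit_modFour` (its hypothesis VERBATIM) ∘ p480035's `abc_of_k2Target27_of_hStar27OnSigma27_hregBad` (cone binder cut to the SZPIRO-BAD
locus). H⋆₂₇ is a HYPOTHESIS, `hregBad` an assumption label; nothing asserted; no side taken on [IUTchIII] Cor. 3.12.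
[cite: Mochizuki2012, IUTchIII Cor. 3.12 p. 173–174; IUTchIV Cor. 2.2 (ii) p. 46] [claim: Mochizuki2012, status: disputed] -/
theorem abc_of_hStar27OnSigma27_of_isGalois_outerUnit_modFour_hregBad (hS : HStar27OnSigma27)
    (hGO : ∀ (P : NFPoint), P ∈ UP → ∀ (l : ℕ), l.Prime → 5 ≤ l →
      Cor22.AdmitsCore P → Cor22.CondP2 P l → Cor22.CondP5 P l → Cor22.CondP6 P l →
      (((l : ℝ) + 5) / 4 < (Cor22.dmod P : ℝ) ∨
        6 * l * (((l : ℝ) + 5) - 4 * Cor22.dmod P) / (((l : ℝ) + 4) * ((l : ℝ) - 3))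
            * (P.logDiff + (1 - 1 / (l : ℝ)) * Cor22.logCondAvoid P {2, l})
          + 6 * l * ((l : ℝ) + 5) / (((l : ℝ) + 4) * ((l : ℝ) - 3)) * Real.log Real.pi < Cor22.logQAvoid P {2, l}) →
      ∀ (T : Cor22.ThetaVolumeDatumAt P l), letI := T.instFieldF; letI := T.instNumberFieldF; letI := T.instAlgebraF; letI := T.instFieldK;
        letI := T.instNumberFieldK; letI := T.instAlgebraK; letI := T.instFieldFbar; letI := T.instAlgebraFbar;
        letI := T.instAlgebraKFbar; letI := T.instIsElliptic;
      ¬ (∃ (pp : Nat.Primes) (_ : 2 < (pp : ℕ)) (i : Fin (thetaIndex (pilotDataOfK T.D T.K)).lstar)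
          (x₀ : (thetaIndex (pilotDataOfK T.D T.K)).Fibre (.inr pp)),
        haveI : Fact (pp : ℕ).Prime := ⟨pp.2⟩
        ((pp : ℕ) : ℝ) ^ ((((i : ℕ) : ℝ) + 2) * (4 + 2 * Real.logb (pp : ℕ) (Module.finrank ℚ T.K)) + 1) *
          ‖(exists_realising_qIdeles_pilotDataOfK T.D).choose pp x₀‖ ^ (((i : ℕ) + 1) ^ 2 - 1) < 1) →
      IsGalois ℚ T.K ∧
      (∀ (pp : Nat.Primes) (w : (thetaIndex (pilotDataOfK T.D T.K)).Fibre (.inr pp)), haveI : Fact (pp : ℕ).Prime := ⟨pp.2⟩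
        placeOf (pilotDataOfK T.D T.K) pp.1 w ∈ (pilotDataOfK T.D T.K).S → (pp : ℕ) % 4 ≠ 3 →
          (∀ a : ℕ, (((placeOf (pilotDataOfK T.D T.K) pp.1 w).asIdeal.ramificationIdx ℤ : ℕ) : ℤ) ≠
              ((pp : ℕ) : ℤ) ^ a * (((pp : ℕ) : ℤ) - 1)) ∨
            ∀ x : (thetaIndex (pilotDataOfK T.D T.K)).Fibre (.inr pp),
              2 ≤ (placeOf (pilotDataOfK T.D T.K) pp.1 x).asIdeal.inertiaDeg ℤ ∨
                ∃ π : kOf (pilotDataOfK T.D T.K) pp.1 x,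
                  ‖π‖ = ((pp : ℕ) : ℝ) ^ (-(1 : ℝ) / ((placeOf (pilotDataOfK T.D T.K) pp.1 w).asIdeal.ramificationIdx ℤ : ℝ)) ∧
                    ‖1 + π ^ ((placeOf (pilotDataOfK T.D T.K) pp.1 w).asIdeal.ramificationIdx ℤ) /
                      ((pp : ℕ) : kOf (pilotDataOfK T.D T.K) pp.1 x)‖ = 1))
    (hNumBad : ∀ (P : NFPoint), P ∈ UP → ∀ (l : ℕ), l.Prime → 5 ≤ l →
      Cor22.AdmitsCore P → Cor22.CondP2 P l → Cor22.CondP5 P l → Cor22.CondP6 P l →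
      -- ONLY at SZPIRO-BAD `(P, l)`: elsewhere `T.Cor312Of` is the theorem `Cor22.ThetaVolumeDatumAt.cor312Of_of_szpiro` (abc-iut-c312-d1)
      (((l : ℝ) + 5) / 4 < (Cor22.dmod P : ℝ) ∨
        6 * l * (((l : ℝ) + 5) - 4 * Cor22.dmod P) / (((l : ℝ) + 4) * ((l : ℝ) - 3))
            * (P.logDiff + (1 - 1 / (l : ℝ)) * Cor22.logCondAvoid P {2, l})
          + 6 * l * ((l : ℝ) + 5) / (((l : ℝ) + 4) * ((l : ℝ) - 3)) * Real.log Real.pi < Cor22.logQAvoid P {2, l}) →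
      ∀ (T : Cor22.ThetaVolumeDatumAt P l), letI := T.instFieldF; letI := T.instNumberFieldF; letI := T.instAlgebraF; letI := T.instFieldK;
        letI := T.instNumberFieldK; letI := T.instAlgebraK; letI := T.instFieldFbar; letI := T.instAlgebraFbar;
        letI := T.instAlgebraKFbar; letI := T.instIsElliptic;
      (∃ (pp : Nat.Primes) (_ : 2 < (pp : ℕ)) (i : Fin (thetaIndex (pilotDataOfK T.D T.K)).lstar)
          (x₀ : (thetaIndex (pilotDataOfK T.D T.K)).Fibre (.inr pp)),
        haveI : Fact (pp : ℕ).Prime := ⟨pp.2⟩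
        ((pp : ℕ) : ℝ) ^ ((((i : ℕ) : ℝ) + 2) * (4 + 2 * Real.logb (pp : ℕ) (Module.finrank ℚ T.K)) + 1) *
          ‖(exists_realising_qIdeles_pilotDataOfK T.D).choose pp x₀‖ ^ (((i : ℕ) + 1) ^ 2 - 1) < 1) → T.Cor312Of)
    -- [CONE, Szpiro-bad] the off-regime hull estimate with print's constant `B_III(P,l)`, demanded ONLY at SZPIRO-BAD admissible `(P, l)`
    (hregBad : ∀ P : NFPoint, P ∈ UP → ∀ l : ℕ, l.Prime → 5 ≤ l →
      Cor22.AdmitsCore P → Cor22.CondP2 P l → Cor22.CondP5 P l → Cor22.CondP6 P l →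
      (((l : ℝ) + 5) / 4 < (Cor22.dmod P : ℝ) ∨
        6 * l * (((l : ℝ) + 5) - 4 * Cor22.dmod P) / (((l : ℝ) + 4) * ((l : ℝ) - 3))
            * (P.logDiff + (1 - 1 / (l : ℝ)) * Cor22.logCondAvoid P {2, l})
          + 6 * l * ((l : ℝ) + 5) / (((l : ℝ) + 4) * ((l : ℝ) - 3)) * Real.log Real.pi < Cor22.logQAvoid P {2, l}) →
      ∀ T : Cor22.ThetaVolumeDatumAt P l,
        (letI := T.instFieldF; letI := T.instNumberFieldF; letI := T.instAlgebraF; letI := T.instFieldK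
         letI := T.instNumberFieldK; letI := T.instAlgebraK; letI := T.instFieldFbar; letI := T.instAlgebraFbar
         letI := T.instAlgebraKFbar; letI := T.instIsElliptic
         ¬ (∀ p ∈ T.I.supportPrimes, ∀ v w : placesOver (fieldOfModuli T.E) p,
            (Summit.ABC.IUTFork.DHData.ofInput T.I).logQloc p v = (Summit.ABC.IUTFork.DHData.ofInput T.I).logQloc p w)) →
        T.HullEstimateOf
          (((l : ℝ) + 1) / 4 *
            ((1 + 12 * (Cor22.dmod P : ℝ) / l) * (P.logDiff + Cor22.logCondAvoid P {2, l})
              + 2 * Real.log l + 52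
              + 20 / 3 * Real.log (((2 ^ 12 * 3 ^ 3 * 5 * Cor22.dmod P : ℕ) : ℝ) * (l : ℝ))
                * (Nat.primeCounting (2 ^ 12 * 3 ^ 3 * 5 * Cor22.dmod P * l) : ℝ))))
    : _root_.ABC :=
  abc_of_k2Target27_of_hStar27OnSigma27_hregBad
    (TieDecider.k2Target27_of_isGalois_outerUnit_modFour M archPk archSub Ψ act Mmod region n lat sig split qData hGO) hS hNumBad hregBad

include M archPk archSub Ψ act Mmod region n lat sig split qData in
/-- **EXPLICIT-4, recut, class `outerUnit` with (O″) owed only at the bad `p ≢ 3 (mod 4)`, RATIONAL-`j` bed: `HStar27OnSigma27 ∧ (j(λ) ∈ ℚ ∧ outerUnit off p ≡ 3 (mod 4))|Σ₂₇ ∧ NUM(deep ∧ bad) ∧ CONE-bad ⟹ ABC`** —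
§1's `k2Target27_of_jInv_mem_range_outerUnit_modFour` ∘ p480035's `abc_of_k2Target27_of_hStar27OnSigma27_hregBad`. H⋆₂₇ is a HYPOTHESIS, `hregBad` an
assumption label; nothing asserted; no side taken on [IUTchIII] Cor. 3.12. [cite: Mochizuki2012, IUTchI Rmk. 3.1.5 p. 65; IUTchIII Cor. 3.12
p. 173–174; IUTchIV Cor. 2.2 (ii) p. 46] [claim: Mochizuki2012, status: disputed] -/
theorem abc_of_hStar27OnSigma27_of_jInv_mem_range_outerUnit_modFour_hregBad (hS : HStar27OnSigma27)
    (hJO : ∀ (P : NFPoint), P ∈ UP → ∀ (l : ℕ), l.Prime → 5 ≤ l →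
      Cor22.AdmitsCore P → Cor22.CondP2 P l → Cor22.CondP5 P l → Cor22.CondP6 P l →
      (((l : ℝ) + 5) / 4 < (Cor22.dmod P : ℝ) ∨
        6 * l * (((l : ℝ) + 5) - 4 * Cor22.dmod P) / (((l : ℝ) + 4) * ((l : ℝ) - 3))
            * (P.logDiff + (1 - 1 / (l : ℝ)) * Cor22.logCondAvoid P {2, l})
          + 6 * l * ((l : ℝ) + 5) / (((l : ℝ) + 4) * ((l : ℝ) - 3)) * Real.log Real.pi < Cor22.logQAvoid P {2, l}) →
      ∀ (T : Cor22.ThetaVolumeDatumAt P l), letI := T.instFieldF; letI := T.instNumberFieldF; letI := T.instAlgebraF; letI := T.instFieldK;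
        letI := T.instNumberFieldK; letI := T.instAlgebraK; letI := T.instFieldFbar; letI := T.instAlgebraFbar;
        letI := T.instAlgebraKFbar; letI := T.instIsElliptic;
      ¬ (∃ (pp : Nat.Primes) (_ : 2 < (pp : ℕ)) (i : Fin (thetaIndex (pilotDataOfK T.D T.K)).lstar)
          (x₀ : (thetaIndex (pilotDataOfK T.D T.K)).Fibre (.inr pp)),
        haveI : Fact (pp : ℕ).Prime := ⟨pp.2⟩
        ((pp : ℕ) : ℝ) ^ ((((i : ℕ) : ℝ) + 2) * (4 + 2 * Real.logb (pp : ℕ) (Module.finrank ℚ T.K)) + 1) *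
          ‖(exists_realising_qIdeles_pilotDataOfK T.D).choose pp x₀‖ ^ (((i : ℕ) + 1) ^ 2 - 1) < 1) →
      Cor22.jInv P.x ∈ Set.range (algebraMap ℚ P.F) ∧
      (∀ (pp : Nat.Primes) (w : (thetaIndex (pilotDataOfK T.D T.K)).Fibre (.inr pp)), haveI : Fact (pp : ℕ).Prime := ⟨pp.2⟩
        placeOf (pilotDataOfK T.D T.K) pp.1 w ∈ (pilotDataOfK T.D T.K).S → (pp : ℕ) % 4 ≠ 3 →
          (∀ a : ℕ, (((placeOf (pilotDataOfK T.D T.K) pp.1 w).asIdeal.ramificationIdx ℤ : ℕ) : ℤ) ≠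
              ((pp : ℕ) : ℤ) ^ a * (((pp : ℕ) : ℤ) - 1)) ∨
            ∀ x : (thetaIndex (pilotDataOfK T.D T.K)).Fibre (.inr pp),
              2 ≤ (placeOf (pilotDataOfK T.D T.K) pp.1 x).asIdeal.inertiaDeg ℤ ∨
                ∃ π : kOf (pilotDataOfK T.D T.K) pp.1 x,
                  ‖π‖ = ((pp : ℕ) : ℝ) ^ (-(1 : ℝ) / ((placeOf (pilotDataOfK T.D T.K) pp.1 w).asIdeal.ramificationIdx ℤ : ℝ)) ∧
                    ‖1 + π ^ ((placeOf (pilotDataOfK T.D T.K) pp.1 w).asIdeal.ramificationIdx ℤ) /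
                      ((pp : ℕ) : kOf (pilotDataOfK T.D T.K) pp.1 x)‖ = 1))
    (hNumBad : ∀ (P : NFPoint), P ∈ UP → ∀ (l : ℕ), l.Prime → 5 ≤ l →
      Cor22.AdmitsCore P → Cor22.CondP2 P l → Cor22.CondP5 P l → Cor22.CondP6 P l →
      -- ONLY at SZPIRO-BAD `(P, l)`: elsewhere `T.Cor312Of` is the theorem `Cor22.ThetaVolumeDatumAt.cor312Of_of_szpiro` (abc-iut-c312-d1)
      (((l : ℝ) + 5) / 4 < (Cor22.dmod P : ℝ) ∨
        6 * l * (((l : ℝ) + 5) - 4 * Cor22.dmod P) / (((l : ℝ) + 4) * ((l : ℝ) - 3))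
            * (P.logDiff + (1 - 1 / (l : ℝ)) * Cor22.logCondAvoid P {2, l})
          + 6 * l * ((l : ℝ) + 5) / (((l : ℝ) + 4) * ((l : ℝ) - 3)) * Real.log Real.pi < Cor22.logQAvoid P {2, l}) →
      ∀ (T : Cor22.ThetaVolumeDatumAt P l), letI := T.instFieldF; letI := T.instNumberFieldF; letI := T.instAlgebraF; letI := T.instFieldK;
        letI := T.instNumberFieldK; letI := T.instAlgebraK; letI := T.instFieldFbar; letI := T.instAlgebraFbar;
        letI := T.instAlgebraKFbar; letI := T.instIsElliptic;
      (∃ (pp : Nat.Primes) (_ : 2 < (pp : ℕ)) (i : Fin (thetaIndex (pilotDataOfK T.D T.K)).lstar)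
          (x₀ : (thetaIndex (pilotDataOfK T.D T.K)).Fibre (.inr pp)),
        haveI : Fact (pp : ℕ).Prime := ⟨pp.2⟩
        ((pp : ℕ) : ℝ) ^ ((((i : ℕ) : ℝ) + 2) * (4 + 2 * Real.logb (pp : ℕ) (Module.finrank ℚ T.K)) + 1) *
          ‖(exists_realising_qIdeles_pilotDataOfK T.D).choose pp x₀‖ ^ (((i : ℕ) + 1) ^ 2 - 1) < 1) → T.Cor312Of)
    -- [CONE, Szpiro-bad] the off-regime hull estimate with print's constant `B_III(P,l)`, demanded ONLY at SZPIRO-BAD admissible `(P, l)`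
    (hregBad : ∀ P : NFPoint, P ∈ UP → ∀ l : ℕ, l.Prime → 5 ≤ l →
      Cor22.AdmitsCore P → Cor22.CondP2 P l → Cor22.CondP5 P l → Cor22.CondP6 P l →
      (((l : ℝ) + 5) / 4 < (Cor22.dmod P : ℝ) ∨
        6 * l * (((l : ℝ) + 5) - 4 * Cor22.dmod P) / (((l : ℝ) + 4) * ((l : ℝ) - 3))
            * (P.logDiff + (1 - 1 / (l : ℝ)) * Cor22.logCondAvoid P {2, l})
          + 6 * l * ((l : ℝ) + 5) / (((l : ℝ) + 4) * ((l : ℝ) - 3)) * Real.log Real.pi < Cor22.logQAvoid P {2, l}) →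
      ∀ T : Cor22.ThetaVolumeDatumAt P l,
        (letI := T.instFieldF; letI := T.instNumberFieldF; letI := T.instAlgebraF; letI := T.instFieldK
         letI := T.instNumberFieldK; letI := T.instAlgebraK; letI := T.instFieldFbar; letI := T.instAlgebraFbar
         letI := T.instAlgebraKFbar; letI := T.instIsElliptic
         ¬ (∀ p ∈ T.I.supportPrimes, ∀ v w : placesOver (fieldOfModuli T.E) p,
            (Summit.ABC.IUTFork.DHData.ofInput T.I).logQloc p v = (Summit.ABC.IUTFork.DHData.ofInput T.I).logQloc p w)) →
        T.HullEstimateOf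
          (((l : ℝ) + 1) / 4 *
            ((1 + 12 * (Cor22.dmod P : ℝ) / l) * (P.logDiff + Cor22.logCondAvoid P {2, l})
              + 2 * Real.log l + 52
              + 20 / 3 * Real.log (((2 ^ 12 * 3 ^ 3 * 5 * Cor22.dmod P : ℕ) : ℝ) * (l : ℝ))
                * (Nat.primeCounting (2 ^ 12 * 3 ^ 3 * 5 * Cor22.dmod P * l) : ℝ))))
    : _root_.ABC :=
  abc_of_k2Target27_of_hStar27OnSigma27_hregBad
    (k2Target27_of_jInv_mem_range_outerUnit_modFour M archPk archSub Ψ act Mmod region n lat sig split qData hJO) hS hNumBad hregBad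

end KFamily

end Summit.ABC.IUTFork.Repair.RH.ReachLedgerQ2

end
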